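import Mathlib.Analysis.SpecialFunctions.Complex.CircleAddChar
import Mathlib.Algebra.Group.AddChar
import Mathlib.NumberTheory.LegendreSymbol.AddCharacter
import Mathlib.LinearAlgebra.Matrix.NonsingularInverse
import Mathlib.Data.ZMod.Basic
import HarnessLib

/-!
# `#H^⊥ · #H = n^m` for a subgroup `H ≤ (ℤ/n)^m` and a non-degenerate bilinear form mod `n`

Layer `Literature/GroupTheory/Abelian`, namespace `Literature.GroupTheory.Abelian.ZModPairing`.  THEOREMS ONLY (no
definition, no named fact).  Cell hodgecm-mathlib (D-0151), Hecke-link socket (B), (K) «stabiliser of `𝒩₁` is the constant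
group `K′ = u(K₀^⊥)`», stub **(K5a)** of B-p15 (g10)'s census `CENSUS-K5-exactness` (I3): the index set of the dual-side
subgroup is the ANNIHILATOR `K₀^⊥ = {c : ∀ a ∈ K₀, ᵗa J c ≡ 0 (mod n)}` of `K₀ ≤ (ℤ/n)^{2g}` for the symplectic form
`J = E_δ`, and the counting step of (K5) needs its order: for `det J` a unit mod `n` (here `(∏ δᵢ)²`, prime to `n = ν`),

  **`#K₀^⊥ · #K₀ = n^{2g}`**   (`natCard_annihilator_mul_natCard`).

Proof (double counting with the standard additive character `ψ = e^{2πi·/n}` of `ℤ/n`, [MumfordAV1970] §23 p. 233 style;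
[SerreLinearRepresentations1977] §2.3-type orthogonality): `S := Σ_{h ∈ H} Σ_{c} ψ(ᵗh J c)`.  For fixed `h`, `c ↦ ψ(ᵗh J c)`
is an additive character of `(ℤ/n)^m`, trivial iff `ᵗh J = 0` iff `h = 0` (`J` invertible, `ψ` primitive), so `S = n^m`
(Mathlib `AddChar.sum_eq_ite`); for fixed `c`, `h ↦ ψ(ᵗh J c)` is an additive character of `H`, trivial iff `c ∈ H^⊥`,
so `S = #H^⊥ · #H`.

* §1 the two characters `rowChar`/`colChar`-free (built inline with `AddChar.compAddMonoidHom`) and their triviality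
  criteria (`vecMul_eq_zero_of_forall`, `forall_pairing_eq_zero_of_forall`);
* §2 **`natCard_annihilator_mul_natCard`** and the `Fin g ⊕ Fin g` spelling used by the Siegel files.

## References

* [MumfordAV1970] D. Mumford, *Abelian Varieties* (1970), §23 (p. 233) (the non-degenerate pairing on `K(L)`, maximal
  isotropic / level subgroups and their orders).
* [SerreLinearRepresentations1977] J.-P. Serre, *Linear Representations of Finite Groups* (1977), §2.3 (orthogonality
  of characters) — the double-counting device.
-/

noncomputable section

open Matrix Finset AddChar

namespace Literature.GroupTheory.Abelian.ZModPairing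

variable {ι : Type*} [Fintype ι] [DecidableEq ι] {n : ℕ}

/-! ### §1 The standard character and the two triviality criteria -/

omit [Fintype ι] [DecidableEq ι] in
/-- The standard character of `ℤ/n` detects `0`: if `ψ(a x) = 1` for all `x` then `a = 0` (primitivity, Mathlib
`ZMod.isPrimitive_stdAddChar`). [cite: SerreLinearRepresentations1977, §2.3] -/
theorem eq_zero_of_forall_stdAddChar_mul_eq_one [NeZero n] {a : ZMod n} (h : ∀ x : ZMod n, ZMod.stdAddChar (a * x) = 1) : a = 0 := by
  by_contra ha
  apply ZMod.isPrimitive_stdAddChar n ha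
  ext x
  rw [mulShift_apply, AddChar.one_apply]
  exact h x

/-- `ᵗh J = 0` forces `h = 0` when `det J` is a unit. [cite: MumfordAV1970, §23 (p. 233)] -/
theorem eq_zero_of_vecMul_eq_zero {J : Matrix ι ι (ZMod n)} (hJ : IsUnit J.det) {h : ι → ZMod n} (hh : h ᵥ* J = 0) :
    h = 0 := by
  have : h ᵥ* (J * J⁻¹) = 0 := by rw [← vecMul_vecMul, hh, zero_vecMul]
  rwa [mul_nonsing_inv J hJ, vecMul_one] at this

omit [DecidableEq ι] in
/-- The additive map `c ↦ ᵗh J c`. [cite: MumfordAV1970, §23 (p. 233)] -/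
theorem pairing_add (J : Matrix ι ι (ZMod n)) (h c c' : ι → ZMod n) :
    h ⬝ᵥ J *ᵥ (c + c') = h ⬝ᵥ J *ᵥ c + h ⬝ᵥ J *ᵥ c' := by
  rw [mulVec_add, dotProduct_add]

omit [DecidableEq ι] in
/-- The additive map `h ↦ ᵗh J c`. [cite: MumfordAV1970, §23 (p. 233)] -/
theorem add_pairing (J : Matrix ι ι (ZMod n)) (h h' c : ι → ZMod n) :
    (h + h') ⬝ᵥ J *ᵥ c = h ⬝ᵥ J *ᵥ c + h' ⬝ᵥ J *ᵥ c := by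
  rw [add_dotProduct]

/-- **Row criterion**: if `ψ(ᵗh J c) = 1` for every `c`, then `h = 0` (test on `c = x • e_i`: `(ᵗh J)_i x`; primitivity;
invertibility of `J`). [cite: MumfordAV1970, §23 (p. 233)] -/
theorem eq_zero_of_forall_stdAddChar_pairing_eq_one [NeZero n] {J : Matrix ι ι (ZMod n)} (hJ : IsUnit J.det) {h : ι → ZMod n}
    (hh : ∀ c : ι → ZMod n, ZMod.stdAddChar (h ⬝ᵥ J *ᵥ c) = 1) : h = 0 := by
  apply eq_zero_of_vecMul_eq_zero hJ
  funext i
  apply eq_zero_of_forall_stdAddChar_mul_eq_one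
  intro x
  have := hh (Pi.single i x)
  rwa [dotProduct_mulVec, dotProduct_single] at this

omit [DecidableEq ι] in
/-- **Column criterion**: for a subgroup `H`, `ψ(ᵗh J c) = 1` for every `h ∈ H` iff `ᵗh J c = 0` for every `h ∈ H` (the
multiples `x • h` stay in `H`; primitivity). [cite: MumfordAV1970, §23 (p. 233)] -/
theorem forall_pairing_eq_zero_iff [NeZero n] (J : Matrix ι ι (ZMod n)) (H : AddSubgroup (ι → ZMod n)) (c : ι → ZMod n) :
    (∀ h ∈ H, ZMod.stdAddChar (h ⬝ᵥ J *ᵥ c) = 1) ↔ ∀ h ∈ H, h ⬝ᵥ J *ᵥ c = 0 := by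
  refine ⟨fun hc h hh => ?_, fun hc h hh => by rw [hc h hh, map_zero_eq_one]⟩
  apply eq_zero_of_forall_stdAddChar_mul_eq_one
  intro x
  have hxh : x • h ∈ H := by
    obtain ⟨k, rfl⟩ := ZMod.natCast_zmod_surjective x
    rw [Nat.cast_smul_eq_nsmul]
    exact H.nsmul_mem hh k
  have := hc (x • h) hxh
  rwa [smul_dotProduct, smul_eq_mul, mul_comm] at this

/-! ### §2 The count -/

/-- **`#H^⊥ · #H = n^m`** for a subgroup `H ≤ (ℤ/n)^ι` and the pairing `ᵗh J c` with `det J` a unit mod `n`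
(double counting `Σ_{h ∈ H} Σ_c ψ(ᵗh J c)`). [cite: MumfordAV1970, §23 (p. 233)] [cite: SerreLinearRepresentations1977, §2.3] -/
theorem natCard_annihilator_mul_natCard [NeZero n] {J : Matrix ι ι (ZMod n)} (hJ : IsUnit J.det) (H : AddSubgroup (ι → ZMod n)) :
    Nat.card {c : ι → ZMod n // ∀ h ∈ H, h ⬝ᵥ J *ᵥ c = 0} * Nat.card H = n ^ Fintype.card ι := by
  classical
  -- the row characters `c ↦ ψ(ᵗh J c)` and the column characters `h ↦ ψ(ᵗh J c)`
  let row : (ι → ZMod n) → AddChar (ι → ZMod n) ℂ := fun h =>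
    ZMod.stdAddChar.compAddMonoidHom
      { toFun := fun c => h ⬝ᵥ J *ᵥ c, map_zero' := by rw [mulVec_zero, dotProduct_zero],
        map_add' := pairing_add J h }
  let col : (ι → ZMod n) → AddChar H ℂ := fun c =>
    ZMod.stdAddChar.compAddMonoidHom
      { toFun := fun h => (h : ι → ZMod n) ⬝ᵥ J *ᵥ c, map_zero' := by rw [AddSubgroup.coe_zero, zero_dotProduct],
        map_add' := fun h h' => by rw [AddSubgroup.coe_add, add_pairing] }
  have hrow : ∀ h c, row h c = ZMod.stdAddChar (h ⬝ᵥ J *ᵥ c) := fun _ _ => rfl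
  have hcol : ∀ (c) (h : H), col c h = ZMod.stdAddChar ((h : ι → ZMod n) ⬝ᵥ J *ᵥ c) := fun _ _ => rfl
  -- the double sum, summed by rows: only `h = 0` contributes
  have hcardV : (Fintype.card (ι → ZMod n) : ℂ) = (n : ℂ) ^ Fintype.card ι := by
    rw [Fintype.card_fun, ZMod.card, Nat.cast_pow]
  have hS₁ : (∑ h : H, ∑ c : ι → ZMod n, row h c) = (n : ℂ) ^ Fintype.card ι := by
    have hterm : ∀ h : H, (∑ c : ι → ZMod n, row h c) = if h = 0 then (n : ℂ) ^ Fintype.card ι else 0 := by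
      intro h
      rw [AddChar.sum_eq_ite]
      by_cases h0 : h = 0
      · have hz : row h = 0 := by
          ext c; rw [hrow, h0, AddSubgroup.coe_zero, zero_dotProduct, map_zero_eq_one, AddChar.zero_apply]
        rw [if_pos hz, if_pos h0, hcardV]
      · have hz : row h ≠ 0 := by
          intro hz
          apply h0
          have h' : (h : ι → ZMod n) = 0 :=
            eq_zero_of_forall_stdAddChar_pairing_eq_one hJ fun c => by rw [← hrow, hz, AddChar.zero_apply]
          exact Subtype.ext h'
        rw [if_neg hz, if_neg h0]
    simp_rw [hterm]
    rw [Finset.sum_ite_eq' Finset.univ (0 : H) (fun _ => (n : ℂ) ^ Fintype.card ι), if_pos (Finset.mem_univ _)]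
  -- summed by columns: `#H` for `c ∈ H^⊥`, else `0`
  have hS₂ : (∑ c : ι → ZMod n, ∑ h : H, col c h) =
      ((Finset.univ.filter fun c : ι → ZMod n => ∀ h ∈ H, h ⬝ᵥ J *ᵥ c = 0).card : ℂ) * Fintype.card H := by
    have hterm : ∀ c : ι → ZMod n, (∑ h : H, col c h) =
        if (∀ h ∈ H, h ⬝ᵥ J *ᵥ c = 0) then (Fintype.card H : ℂ) else 0 := by
      intro c
      rw [AddChar.sum_eq_ite]
      by_cases hc : ∀ h ∈ H, h ⬝ᵥ J *ᵥ c = 0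
      · have hz : col c = 0 := by
          ext h; rw [hcol, hc h h.2, map_zero_eq_one, AddChar.zero_apply]
        rw [if_pos hz, if_pos hc]
      · have hz : col c ≠ 0 := by
          intro hz
          apply hc
          rw [← forall_pairing_eq_zero_iff]
          intro h hh
          rw [← hcol c ⟨h, hh⟩, hz, AddChar.zero_apply]
        rw [if_neg hz, if_neg hc]
    simp_rw [hterm]
    rw [Finset.sum_ite, Finset.sum_const_zero, add_zero, Finset.sum_const, nsmul_eq_mul]
  -- the two summations agree
  have hS : (∑ h : H, ∑ c : ι → ZMod n, row h c) = ∑ c : ι → ZMod n, ∑ h : H, col c h := by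
    rw [Finset.sum_comm]
    exact Finset.sum_congr rfl fun c _ => Finset.sum_congr rfl fun h _ => by rw [hrow, hcol]
  rw [hS₁, hS₂] at hS
  rw [Nat.card_eq_fintype_card, Nat.card_eq_fintype_card, Fintype.card_subtype]
  exact_mod_cast hS.symm

/-- The same count with the annihilator written on the LEFT (`ᵗc J h = 0`), for `Jᵀ` also of unit determinant — the
shape `⟨a, c⟩_J ≡ 0 ∀ a ∈ K₀` of (P1) read as `ᵗa J c`. (Restatement for the transposed form; `det Jᵀ = det J`.)
[cite: MumfordAV1970, §23 (p. 233)] -/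
theorem natCard_annihilator_mul_natCard' [NeZero n] {J : Matrix ι ι (ZMod n)} (hJ : IsUnit J.det) (H : AddSubgroup (ι → ZMod n)) :
    Nat.card {c : ι → ZMod n // ∀ h ∈ H, c ⬝ᵥ J *ᵥ h = 0} * Nat.card H = n ^ Fintype.card ι := by
  have hJt : IsUnit Jᵀ.det := by rwa [det_transpose]
  have key := natCard_annihilator_mul_natCard hJt H
  have hiff : ∀ c : ι → ZMod n, (∀ h ∈ H, h ⬝ᵥ Jᵀ *ᵥ c = 0) ↔ ∀ h ∈ H, c ⬝ᵥ J *ᵥ h = 0 := by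
    intro c
    refine forall₂_congr fun h _ => ?_
    rw [dotProduct_mulVec, vecMul_transpose, dotProduct_comm]
  rw [← key]
  congr 1
  exact Nat.card_congr (Equiv.subtypeEquivRight fun c => (hiff c).symm)

/-- **The Siegel spelling** (`ι = Fin g ⊕ Fin g`, `#ι = 2g`): `#H^⊥ · #H = n^{2g}`. [cite: MumfordAV1970, §23 (p. 233)] -/
theorem natCard_annihilator_mul_natCard_sum [NeZero n] {g : ℕ} {J : Matrix (Fin g ⊕ Fin g) (Fin g ⊕ Fin g) (ZMod n)}
    (hJ : IsUnit J.det) (H : AddSubgroup (Fin g ⊕ Fin g → ZMod n)) :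
    Nat.card {c : Fin g ⊕ Fin g → ZMod n // ∀ h ∈ H, h ⬝ᵥ J *ᵥ c = 0} * Nat.card H = n ^ (2 * g) := by
  rw [natCard_annihilator_mul_natCard hJ H, Fintype.card_sum, Fintype.card_fin, two_mul]

end Literature.GroupTheory.Abelian.ZModPairing

end
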